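import Literature.Probability.LatticeModels.EffectiveResistance
import Literature.Probability.LatticeModels.DomainDiscretisation
import Literature.Probability.RandomPlanarGeometry.PlanarDomains
import Literature.Analysis.Complex.ExtremalLength
import Literature.Probability.LatticeModels.SquareTilingConjugate
import HarnessLib

/-!
# Route CardyUSTContinuation — item `KirchhoffExtremalLength` (stmt-CriticalPhenomena-11234): definitions

The one object posited by the reduction of the route item `KirchhoffExtremalLength` proved in
`CardyUSTContinuationKirchhoffExtremalLengthReduction.lean`
(`KirchhoffSlope.kirchhoffExtremalLength_of_conductance_tendsto'`): the **convergence of the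
effective conductance between the discrete arcs to the reciprocal extremal distance**, for the
discretisation `Ω_δ = discreteDomainGraph Ω δ` (largest component of `Ω ∩ δℤ²`, closed mesh edges
in `Ω̄`) with the discrete arcs `discreteArc` (boundary vertices closest to the arc) of
`DomainDiscretisation.lean`, along ALL meshes `δ → 0⁺` and for EVERY conformal rectangle. This is
the `meshDomain`/`discreteArc` analogue of Georgakopoulos–Panagiotis, arXiv:1910.06886,
Corollary 4.15 — proved in the tree (`GeorgakopoulosPanagiotis2019_cor415_holds`) for THEIR
discretisation (`SquareTiling.domainGraph`: component of the origin, open mesh edges in `Ω`, arcs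
by incidence) along the dyadic meshes `2⁻ⁿ`, under `0 ∈ Ω` and the standing separation
assumption. With it, `KirchhoffExtremalLength` holds (the Kirchhoff slope of the jointly-wired
self-dual FK crossing probability IS this conductance for small `δ`, and the reciprocal extremal
distance IS `₂F₁(½,½;1;η)/₂F₁(½,½;1;1-η)` at the cross-ratio `η` of every uniformizing datum —
both proved in the companion files); conversely the item determines the slope, so it is
equivalent to this statement. Known obstacles: for Jordan curves of positive area the
largest-component rule of `meshDomain` is not known to select the bulk component
(`MeshDomainBulk.lean`); for null-boundary domains the statement is expected to follow from the
[GP19] argument transposed to this discretisation.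

Only a definition; no theorem.
-/

noncomputable section

namespace Summit.CriticalPhenomena.CardyFormulaZ2.Theorems.KirchhoffSlope

open Filter Topology
open Literature.Probability.LatticeModels Literature.Probability.RandomPlanarGeometry

/-- **Convergence of the discrete conductance between the arcs to the reciprocal extremal
distance (G02 discretisation).** For every conformal rectangle `R = (Ω; a, b, c, d)`, the
unit-conductance effective conductance between the discrete arcs of `(ab)` and `(cd)` in
`Ω_δ = discreteDomainGraph Ω δ` tends, as the mesh `δ → 0⁺`, to `d_Ω((ab), (cd))⁻¹`, the
reciprocal of Ahlfors' extremal distance between the arcs (both sides read in `ℝ` through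
`ENNReal.toReal`). A route-posited statement (NOT a published result): the `meshDomain`/`discreteArc`
analogue of Georgakopoulos–Panagiotis 2019, Cor. 4.15, and the hypothesis of
`kirchhoffExtremalLength_of_conductance_tendsto'`; it is the residual crux of the item. -/
def G02ModulusConvergence : Prop :=
  ∀ R : ConformalRectangle, Tendsto (fun δ : ℝ =>
      (effectiveConductance (discreteDomainGraph R.carrier δ) 1
        (discreteArc R.carrier δ (R.arc 0)) (discreteArc R.carrier δ (R.arc 2))).toReal)
    (𝓝[>] 0)
    (𝓝 ((Literature.Analysis.Complex.extremalDistance R.carrier (R.arc 0) (R.arc 2))⁻¹).toReal)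

/-! ### The dual objects of `Ω_δ` (second appendix: inner faces, face graph, current, conjugate)

The objects of the discrete-harmonic-conjugate proof of the upper half
`lim sup_{δ→0⁺} 𝒞(A_δ ↔ B_δ; Ω_δ) ≤ d_Ω((ab),(cd))⁻¹` of `G02ModulusConvergence` — the
`discreteDomainGraph` counterparts of `SquareTiling.IsInnerSq`, `SquareTiling.dualGraph`,
`SquareTiling.cur`, `SquareTiling.curH`, `SquareTiling.curV`, `SquareTiling.dualPot`,
`SquareTiling.exitVal` of `SquareTilingConjugate.lean` ([GP19] §3.1–3.2), which are tied to the
Georgakopoulos–Panagiotis graph `SquareTiling.domainGraph`. Only the graph changes; the flux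
bookkeeping (`SquareTiling.stepFlux`, `SquareTiling.walkFlux`) is the tree's. -/

/-- The unit square of `ℤ²` with lower-left corner `p` is an **inner face** of
`Ω_δ = discreteDomainGraph Ω δ` when its four sides are edges of `Ω_δ` (the bounded faces of the
plane graph `Ω_δ`; cf. `SquareTiling.IsInnerSq`, [GP19] §3.1). [cite: GeorgakopoulosPanagiotis2019, §3.1] -/
def IsInnerFace (Ω : Set ℂ) (δ : ℝ) (p : Site 2) : Prop :=
  (discreteDomainGraph Ω δ).Adj p (p + Pi.single 0 1) ∧
  (discreteDomainGraph Ω δ).Adj (p + Pi.single 1 1) (p + Pi.single 1 1 + Pi.single 0 1) ∧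
  (discreteDomainGraph Ω δ).Adj p (p + Pi.single 1 1) ∧
  (discreteDomainGraph Ω δ).Adj (p + Pi.single 0 1) (p + Pi.single 0 1 + Pi.single 1 1)

/-- The **face graph** (dual graph) of `Ω_δ`: two lattice-adjacent inner faces are joined, across
their common side, which is an edge of `Ω_δ` (cf. `SquareTiling.dualGraph`). [cite: GeorgakopoulosPanagiotis2019, §3.1] -/
def faceGraph (Ω : Set ℂ) (δ : ℝ) : SimpleGraph (Site 2) :=
  SimpleGraph.fromRel fun p p' => (zdGraph 2).Adj p p' ∧ IsInnerFace Ω δ p ∧ IsInnerFace Ω δ p'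

/-- The face graph is a subgraph of the lattice `ℤ²` (on square indices). [folklore] -/
theorem faceGraph_le_zdGraph (Ω : Set ℂ) (δ : ℝ) : faceGraph Ω δ ≤ zdGraph 2 := by
  intro p p' h
  simp only [faceGraph, SimpleGraph.fromRel_adj, ne_eq] at h
  rcases h.2 with h' | h'
  · exact h'.1
  · exact h'.1.symm

open Classical in
/-- The **current** of a potential `h` along the directed lattice edge `x → y` of `Ω_δ` (zero on
non-edges): `i(x → y) = h x - h y` (cf. `SquareTiling.cur`, [GP19] §2.3). [cite: GeorgakopoulosPanagiotis2019, §2.3] -/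
def ecur (Ω : Set ℂ) (δ : ℝ) (h : Site 2 → ℝ) (x y : Site 2) : ℝ :=
  if (discreteDomainGraph Ω δ).Adj x y then h x - h y else 0

/-- The current along the horizontal edge from the lattice point `u + (1,1)` rightwards, in the
indexing of `SquareTiling.stepFlux` (cf. `SquareTiling.curH`). [folklore] -/
def ecurH (Ω : Set ℂ) (δ : ℝ) (h : Site 2 → ℝ) (u : Site 2) : ℝ :=
  ecur Ω δ h (u + 1) (u + 1 + Pi.single 0 1)

/-- The current along the vertical edge from the lattice point `u + (1,1)` upwards (cf.
`SquareTiling.curV`). [folklore] -/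
def ecurV (Ω : Set ℂ) (δ : ℝ) (h : Site 2 → ℝ) (u : Site 2) : ℝ :=
  ecur Ω δ h (u + 1) (u + 1 + Pi.single 1 1)

open Classical in
/-- **The discrete conjugate** of the potential `h` on the inner faces of `Ω_δ`, normalised at
the base face `p₀`: the flux of the current of `h` through any walk of the face graph from `p₀`
(zero off the face component of `p₀`; cf. `SquareTiling.dualPot`, [GP19] §3.1–3.2).
[cite: GeorgakopoulosPanagiotis2019, §3.1] -/
def facePot (Ω : Set ℂ) (δ : ℝ) (h : Site 2 → ℝ) (p₀ p : Site 2) : ℝ :=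
  if hp : (faceGraph Ω δ).Reachable p₀ p then
    SquareTiling.walkFlux (ecurH Ω δ h) (ecurV Ω δ h)
      (hp.some.map (SimpleGraph.Hom.ofLE (faceGraph_le_zdGraph Ω δ)))
  else 0

/-- The **virtual value** of the conjugate across the side of the face `p` towards its lattice
neighbour `p'`: `facePot p` plus the Cauchy–Riemann increment (the value at `p'` when `p'` is
an inner face of the component, the value at the corresponding vertex of the outer face when
`(p, p')` is an exit; cf. `SquareTiling.exitVal`, [GP19] §3.1). [cite: GeorgakopoulosPanagiotis2019, §3.1] -/
def faceExitVal (Ω : Set ℂ) (δ : ℝ) (h : Site 2 → ℝ) (p₀ p p' : Site 2) : ℝ :=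
  facePot Ω δ h p₀ p + SquareTiling.stepFlux (ecurH Ω δ h) (ecurV Ω δ h) p p'

end Summit.CriticalPhenomena.CardyFormulaZ2.Theorems.KirchhoffSlope
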